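import Literature.AlgebraicGeometry.Hu2025.Proofs.S05ThetaBlowups.Cor518
/-!
# Hu 2025 §5.1/§5.3 — KERNEL SUPPORT on the typed carrier (rows 106a–c): monomials and exponents under the blow-up steps,
# words of steps, and the term-wise proper transform at the OWN block (used by `Disp516`)

M-HU PREP by res-type-023 (gen 9), 2026-08-27 — FILED by res-type-055 (gen 9) as PARTITION-HU §3b HELPER for the row-106 owner res-type-023 (author of record; res-plan-2 IDLE POOL DEAL #4b 2026-08-27T08:54:38Z; helper TAKING 08:56:19Z, no objection) from the owner's deposited copy of record HOME/plan/tools/res-type-023/hu/file/Disp516Word.lean sha16 ce12fccdfa6dea85, UNCHANGED except this filing note; S files R106cThetaBlowups = p518536 · R106dThetaEquations = p521266; Proofs chain Charts = p514775 · Prop511 = p519351 · Prop511L = p523180 · Cor518 = p524076 (target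
`Literature/AlgebraicGeometry/Hu2025/Proofs/S05ThetaBlowups/Disp516Word.lean`). Theorems about OUR carriers (`ChartStep.pullback`,
`ChartStep.pullbackExp`, `ChartStep.properTransform`, `ChartSeq.*`); nothing of [Hu25] is asserted. AI work, weaker than expert review.

* `ChartStep.pullback_monomial` / `ChartSeq.pullback_monomial`: the pull-back (Def. 5.4 substitution C35L26–L29) of a monomial is the
  monomial of the pulled-back exponent — the «monomials x̃_{𝔙,w} = π^* x_{𝔙_[0],w}» of Prop. 5.16 (C38L147–L150);
* `ChartSeq.properTransform_of_plus_untouched`: along a word whose centres avoid the plus term (and a fixed factor of the minus term)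
  the iterated term-wise proper transform (Def. 5.13 C38L64–L73) performs NO division and only pulls back the remaining factor;
* `ChartStep.properTransform_own_block_rho/_pi`: at the own block the division is by `ζ¹` in both chart kinds — the computation of
  the printed proof of Prop. 5.16, C39L47–L58 (ϱ-chart / Λ^o) and C39L86–L92 (ϖ-chart);
* list bookkeeping `range_filter_lt` for the words of the charts.
-/

noncomputable section

open MvPolynomial

namespace Literature.AlgebraicGeometry.Hu2025.Statements.S05ThetaBlowups

universe u v

variable {R : Type u} [CommRing R] {V : Type v} [DecidableEq V]

/-! ## Exponent bookkeeping of one step -/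

namespace ChartStep

variable (s : ChartStep V)

omit [DecidableEq V] in
/-- `m_{φ,T} = 0` when no variable of `T` lies in `φ` (C35L21–L22). [cite: Hu2025, Def. 5.4 / Def. 5.13 / Prop. 5.16, pp. 80, 88–92 (unrefereed preprint arXiv:2507.21400v1 under adjudication, D-0012/D-0089 — kernel support on OUR typed carrier of row 106; nothing of the source asserted)] -/
theorem phiDeg_eq_zero' {φ : Finset V} {T : V →₀ ℕ} (h : ∀ j ∈ φ, T j = 0) : phiDeg φ T = 0 :=
  Finset.sum_eq_zero h

/-- The exponent pull-back is additive (one step / along a word). [cite: Hu2025, Def. 5.4 / Def. 5.13 / Prop. 5.16, pp. 80, 88–92 (unrefereed preprint arXiv:2507.21400v1 under adjudication, D-0012/D-0089 — kernel support on OUR typed carrier of row 106; nothing of the source asserted)] -/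
theorem pullbackExp_add (T₁ T₂ : V →₀ ℕ) : s.pullbackExp (T₁ + T₂) = s.pullbackExp T₁ + s.pullbackExp T₂ := by
  simp only [pullbackExp, Finsupp.coe_add, Pi.add_apply, Finset.sum_add_distrib, Finsupp.single_add]
  abel

/-- The exponent pull-back of the trivial monomial is trivial. [cite: Hu2025, Def. 5.4 / Def. 5.13 / Prop. 5.16, pp. 80, 88–92 (unrefereed preprint arXiv:2507.21400v1 under adjudication, D-0012/D-0089 — kernel support on OUR typed carrier of row 106; nothing of the source asserted)] -/
theorem pullbackExp_zero : s.pullbackExp 0 = 0 := by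
  simp [pullbackExp]

/-- If no variable of `T` other than possibly `ζ` lies in the centre, the pull-back does not change `T`.
[cite: Hu2025, Def. 5.4 / Def. 5.13 / Prop. 5.16, pp. 80, 88–92 (unrefereed preprint arXiv:2507.21400v1 under adjudication, D-0012/D-0089 — kernel support on OUR typed carrier of row 106; nothing of the source asserted)] -/
theorem pullbackExp_eq_self {T : V →₀ ℕ} (h : ∀ j ∈ s.centre, j ≠ s.exc → T j = 0) : s.pullbackExp T = T := by
  have : ∑ j ∈ s.centre.erase s.exc, T j = 0 :=
    Finset.sum_eq_zero fun j hj => h j (Finset.mem_of_mem_erase hj) (Finset.ne_of_mem_erase hj)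
  simp [pullbackExp, this]

/-- Pull-back of a single variable, on exponents.
[cite: Hu2025, Def. 5.4 / Def. 5.13 / Prop. 5.16, pp. 80, 88–92 (unrefereed preprint arXiv:2507.21400v1 under adjudication, D-0012/D-0089 — kernel support on OUR typed carrier of row 106; nothing of the source asserted)] -/
theorem pullbackExp_single (i : V) (k : ℕ) :
    s.pullbackExp (Finsupp.single i k) =
      Finsupp.single i k + Finsupp.single s.exc (if i ∈ s.centre ∧ i ≠ s.exc then k else 0) := by
  simp only [pullbackExp]
  congr 1
  congr 1
  by_cases hi : i ∈ s.centre ∧ i ≠ s.exc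
  · rw [if_pos hi, Finset.sum_eq_single_of_mem i (Finset.mem_erase.mpr ⟨hi.2, hi.1⟩)
      (fun j _ hji => by simp [Ne.symm hji]), Finsupp.single_eq_same]
  · rw [if_neg hi]
    refine Finset.sum_eq_zero fun j hj => ?_
    rw [Finsupp.single_apply, if_neg]
    rintro rfl
    exact hi ⟨Finset.mem_of_mem_erase hj, Finset.ne_of_mem_erase hj⟩

/-- **The pull-back of a monomial is the monomial of the pulled-back exponent** (Def. 5.4 substitution C35L26–L29 on terms).
[cite: Hu2025, Def. 5.4 / Def. 5.13 / Prop. 5.16, pp. 80, 88–92 (unrefereed preprint arXiv:2507.21400v1 under adjudication, D-0012/D-0089 — kernel support on OUR typed carrier of row 106; nothing of the source asserted)] -/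
theorem pullback_monomial (T : V →₀ ℕ) (a : R) :
    s.pullback (R := R) (monomial T a) = monomial (s.pullbackExp T) a := by
  induction T using Finsupp.induction with
  | zero => simp [pullbackExp_zero, pullback]
  | single_add i k T hi hk ih =>
    have h1 : s.pullback (R := R) (monomial (Finsupp.single i k) 1) = monomial (s.pullbackExp (Finsupp.single i k)) 1 := by
      rw [← X_pow_eq_monomial, map_pow, pullback_X, pullbackExp_single]
      by_cases h : i ∈ s.centre ∧ i ≠ s.exc
      · rw [if_pos h, if_pos h, mul_pow, X_pow_eq_monomial, X_pow_eq_monomial, monomial_mul, one_mul, add_comm]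
      · rw [if_neg h, if_neg h, Finsupp.single_zero, add_zero, X_pow_eq_monomial]
    rw [show monomial (Finsupp.single i k + T) a = monomial (Finsupp.single i k) (1 : R) * monomial T a by
          rw [monomial_mul, one_mul],
      map_mul, ih, h1, monomial_mul, one_mul, pullbackExp_add]

omit [DecidableEq V] in
/-- `toPoly` through `monomial`.
[cite: Hu2025, Def. 5.4 / Def. 5.13 / Prop. 5.16, pp. 80, 88–92 (unrefereed preprint arXiv:2507.21400v1 under adjudication, D-0012/D-0089 — kernel support on OUR typed carrier of row 106; nothing of the source asserted)] -/
theorem _root_.Literature.AlgebraicGeometry.Hu2025.Statements.S05ThetaBlowups.Binomial.toPoly_eq (B : Binomial V) :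
    B.toPoly (R := R) = monomial B.plus 1 - monomial B.minus 1 := rfl

end ChartStep

/-! ## Words: append, monomials, exponents -/

namespace ChartSeq

/-- Exponent bookkeeping along a word (root first).
[cite: Hu2025, Def. 5.4 / Def. 5.13 / Prop. 5.16, pp. 80, 88–92 (unrefereed preprint arXiv:2507.21400v1 under adjudication, D-0012/D-0089 — kernel support on OUR typed carrier of row 106; nothing of the source asserted)] -/
def pullbackExp (w : ChartSeq V) (T : V →₀ ℕ) : V →₀ ℕ := w.foldl (fun T s => s.pullbackExp T) T

/-- Composite pull-back along a concatenated word: first `w₁`, then `w₂`. [cite: Hu2025, Def. 5.4 / Def. 5.13 / Prop. 5.16, pp. 80, 88–92 (unrefereed preprint arXiv:2507.21400v1 under adjudication, D-0012/D-0089 — kernel support on OUR typed carrier of row 106; nothing of the source asserted)] -/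
theorem pullback_append (w₁ w₂ : ChartSeq V) (f : MvPolynomial V R) :
    ChartSeq.pullback (R := R) (w₁ ++ w₂) f = ChartSeq.pullback (R := R) w₂ (ChartSeq.pullback (R := R) w₁ f) := by
  induction w₁ generalizing f with
  | nil => rfl
  | cons s w ih => rw [List.cons_append, pullback_cons, pullback_cons, ih]

/-- Composite pull-back along a one-step word is that step's pull-back. [cite: Hu2025, Def. 5.4 / Def. 5.13 / Prop. 5.16, pp. 80, 88–92 (unrefereed preprint arXiv:2507.21400v1 under adjudication, D-0012/D-0089 — kernel support on OUR typed carrier of row 106; nothing of the source asserted)] -/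
theorem pullback_singleton (s : ChartStep V) (f : MvPolynomial V R) :
    ChartSeq.pullback (R := R) [s] f = s.pullback (R := R) f := rfl

/-- Iterated term-wise transform along `w ++ [s]`: the word `w`, then the step `s` (Def. 5.13 C38L69–L73). [cite: Hu2025, Def. 5.4 / Def. 5.13 / Prop. 5.16, pp. 80, 88–92 (unrefereed preprint arXiv:2507.21400v1 under adjudication, D-0012/D-0089 — kernel support on OUR typed carrier of row 106; nothing of the source asserted)] -/
theorem properTransform_append_singleton (w : ChartSeq V) (s : ChartStep V) (B : Binomial V) :
    ChartSeq.properTransform (w ++ [s]) B = s.properTransform (ChartSeq.properTransform w B) := by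
  simp [ChartSeq.properTransform, List.foldl_append]

/-- Exponent pull-back along the empty word is the identity. [cite: Hu2025, Def. 5.4 / Def. 5.13 / Prop. 5.16, pp. 80, 88–92 (unrefereed preprint arXiv:2507.21400v1 under adjudication, D-0012/D-0089 — kernel support on OUR typed carrier of row 106; nothing of the source asserted)] -/
theorem pullbackExp_nil (T : V →₀ ℕ) : pullbackExp ([] : ChartSeq V) T = T := rfl

/-- Exponent pull-back along `s :: w`: first `s`, then `w`. [cite: Hu2025, Def. 5.4 / Def. 5.13 / Prop. 5.16, pp. 80, 88–92 (unrefereed preprint arXiv:2507.21400v1 under adjudication, D-0012/D-0089 — kernel support on OUR typed carrier of row 106; nothing of the source asserted)] -/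
theorem pullbackExp_cons (s : ChartStep V) (w : ChartSeq V) (T : V →₀ ℕ) :
    pullbackExp (s :: w) T = pullbackExp w (s.pullbackExp T) := rfl

/-- Exponent pull-back along `w ++ [s]`: the word `w`, then the step `s`. [cite: Hu2025, Def. 5.4 / Def. 5.13 / Prop. 5.16, pp. 80, 88–92 (unrefereed preprint arXiv:2507.21400v1 under adjudication, D-0012/D-0089 — kernel support on OUR typed carrier of row 106; nothing of the source asserted)] -/
theorem pullbackExp_append_singleton (w : ChartSeq V) (s : ChartStep V) (T : V →₀ ℕ) :
    pullbackExp (w ++ [s]) T = s.pullbackExp (pullbackExp w T) := by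
  simp [pullbackExp, List.foldl_append]

/-- The exponent pull-back is additive (one step / along a word). [cite: Hu2025, Def. 5.4 / Def. 5.13 / Prop. 5.16, pp. 80, 88–92 (unrefereed preprint arXiv:2507.21400v1 under adjudication, D-0012/D-0089 — kernel support on OUR typed carrier of row 106; nothing of the source asserted)] -/
theorem pullbackExp_add (w : ChartSeq V) (T₁ T₂ : V →₀ ℕ) :
    pullbackExp w (T₁ + T₂) = pullbackExp w T₁ + pullbackExp w T₂ := by
  induction w generalizing T₁ T₂ with
  | nil => rfl
  | cons s w ih => rw [pullbackExp_cons, pullbackExp_cons, pullbackExp_cons, s.pullbackExp_add, ih]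

/-- **The pull-back of a monomial is the monomial of the pulled-back exponent** (Def. 5.4 substitution C35L26–L29; along a word: the monomials `x̃` of C38L147–L150). [cite: Hu2025, Def. 5.4 / Def. 5.13 / Prop. 5.16, pp. 80, 88–92 (unrefereed preprint arXiv:2507.21400v1 under adjudication, D-0012/D-0089 — kernel support on OUR typed carrier of row 106; nothing of the source asserted)] -/
theorem pullback_monomial (w : ChartSeq V) (T : V →₀ ℕ) (a : R) :
    ChartSeq.pullback (R := R) w (monomial T a) = monomial (pullbackExp w T) a := by
  induction w generalizing T with
  | nil => rfl
  | cons s w ih => rw [pullback_cons, s.pullback_monomial, ih, pullbackExp_cons]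

/-- A variable lying in no centre of the word is not moved by the composite pull-back.
[cite: Hu2025, Def. 5.4 / Def. 5.13 / Prop. 5.16, pp. 80, 88–92 (unrefereed preprint arXiv:2507.21400v1 under adjudication, D-0012/D-0089 — kernel support on OUR typed carrier of row 106; nothing of the source asserted)] -/
theorem pullback_X_of_forall_not_mem (w : ChartSeq V) {y : V} (h : ∀ s ∈ w, y ∉ s.centre) :
    ChartSeq.pullback (R := R) w (X y) = X y := by
  induction w with
  | nil => rfl
  | cons s w ih =>
    rw [pullback_cons, s.pullback_X_of_not_mem (h s (by simp)), ih fun s' hs' => h s' (by simp [hs'])]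

/-- If no centre of the word meets `T` outside the exceptional indices, the exponent is not moved.
[cite: Hu2025, Def. 5.4 / Def. 5.13 / Prop. 5.16, pp. 80, 88–92 (unrefereed preprint arXiv:2507.21400v1 under adjudication, D-0012/D-0089 — kernel support on OUR typed carrier of row 106; nothing of the source asserted)] -/
theorem pullbackExp_eq_self (w : ChartSeq V) {T : V →₀ ℕ} (h : ∀ s ∈ w, ∀ j ∈ s.centre, T j = 0) :
    pullbackExp w T = T := by
  induction w with
  | nil => rfl
  | cons s w ih =>
    rw [pullbackExp_cons, s.pullbackExp_eq_self fun j hj _ => h s (by simp) j hj,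
      ih fun s' hs' => h s' (by simp [hs'])]

/-- **Invariant before the own block:** along a word whose centres do not meet the plus term nor the fixed part `E` of the minus
term, the iterated term-wise proper transform only pulls back the remaining factor `M` of the minus term (no division occurs:
`l_{φ,B} = 0` at every step).
[cite: Hu2025, Def. 5.4 / Def. 5.13 / Prop. 5.16, pp. 80, 88–92 (unrefereed preprint arXiv:2507.21400v1 under adjudication, D-0012/D-0089 — kernel support on OUR typed carrier of row 106; nothing of the source asserted)] -/
theorem properTransform_of_plus_untouched (w : ChartSeq V) (plus E M : V →₀ ℕ)
    (hplus : ∀ s ∈ w, ∀ j ∈ s.centre, plus j = 0) (hE : ∀ s ∈ w, ∀ j ∈ s.centre, E j = 0) :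
    ChartSeq.properTransform w ⟨plus, E + M⟩ = ⟨plus, E + pullbackExp w M⟩ := by
  induction w generalizing M with
  | nil => rfl
  | cons s w ih =>
    have hp : ∀ j ∈ s.centre, plus j = 0 := hplus s (by simp)
    have he : ∀ j ∈ s.centre, E j = 0 := hE s (by simp)
    have hl : lPhi s.centre plus (E + M) = 0 := by
      simp [lPhi, ChartStep.phiDeg_eq_zero' hp]
    have hstep : s.properTransform ⟨plus, E + M⟩ = ⟨plus, E + s.pullbackExp M⟩ := by
      simp only [ChartStep.properTransform, hl, Finsupp.single_zero, tsub_zero]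
      rw [s.pullbackExp_eq_self fun j hj _ => hp j hj, s.pullbackExp_add, s.pullbackExp_eq_self fun j hj _ => he j hj]
    show ChartSeq.properTransform w (s.properTransform ⟨plus, E + M⟩) = _
    rw [hstep, ih (s.pullbackExp M) (fun s' hs' => hplus s' (by simp [hs'])) (fun s' hs' => hE s' (by simp [hs'])),
      pullbackExp_cons]

end ChartSeq

namespace ChartStep

variable (s : ChartStep V)

/-- Exponent at a non-exceptional index is not moved by one step.
[cite: Hu2025, Def. 5.4 / Def. 5.13 / Prop. 5.16, pp. 80, 88–92 (unrefereed preprint arXiv:2507.21400v1 under adjudication, D-0012/D-0089 — kernel support on OUR typed carrier of row 106; nothing of the source asserted)] -/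
theorem pullbackExp_apply_of_ne_exc (T : V →₀ ℕ) {v : V} (hv : v ≠ s.exc) : s.pullbackExp T v = T v := by
  simp [pullbackExp, Ne.symm hv]

/-- **The own block, ϱ-standard chart** (exceptional index `d = x_{(m,u_k)}`, centre `{y, d}` with `y = x_{u_k}`): for a binomial
`(A·y) − (d·M)` with `A`, `M` free of `y`-… as in `B_(kτ)` pulled back to `𝔙'` (`A = x_{(u_s,v_s)}`, `M = x̃_{u_s} x̃_{v_s}`), the
term-wise proper transform divides by `ζ = d` exactly once: plus term unchanged, minus term `π^* M` (display (A), C39L47–L58 /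
C39L86–L89).
[cite: Hu2025, Def. 5.4 / Def. 5.13 / Prop. 5.16, pp. 80, 88–92 (unrefereed preprint arXiv:2507.21400v1 under adjudication, D-0012/D-0089 — kernel support on OUR typed carrier of row 106; nothing of the source asserted)] -/
theorem properTransform_own_block_rho {y d : V} (hyd : y ≠ d) (hc : s.centre = {y, d}) (he : s.exc = d)
    (A M : V →₀ ℕ) (hAy : A y = 0) (hAd : A d = 0) (hMd : M d = 0) :
    s.properTransform ⟨A + Finsupp.single y 1, Finsupp.single d 1 + M⟩ =
      ⟨A + Finsupp.single y 1, s.pullbackExp M⟩ := by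
  have hdy : d ≠ y := fun h => hyd h.symm
  have herase : s.centre.erase d = {y} := by
    rw [hc, Finset.erase_insert_of_ne hyd, Finset.erase_singleton]
    simp
  have hl : lPhi s.centre (A + Finsupp.single y 1) (Finsupp.single d 1 + M) = 1 := by
    simp only [lPhi, phiDeg, hc, Finset.sum_pair hyd, Finsupp.coe_add, Pi.add_apply, hAy, hAd, hMd,
      Finsupp.single_apply, hyd, hdy, if_true, if_false]
    omega
  simp only [ChartStep.properTransform, hl, Binomial.mk.injEq]
  constructor
  · ext v
    simp only [pullbackExp, he, herase, Finset.sum_singleton, Finsupp.coe_add, Finsupp.coe_tsub, Pi.add_apply,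
      Pi.sub_apply, Finsupp.single_apply, hAy, if_true]
    split_ifs <;> omega
  · ext v
    simp only [pullbackExp, he, herase, Finset.sum_singleton, Finsupp.coe_add, Finsupp.coe_tsub, Pi.add_apply,
      Pi.sub_apply, Finsupp.single_apply, hdy, if_false]
    split_ifs <;> omega

/-- **The own block, ϖ-standard chart** (exceptional index `y = x_{u_k}`): the plus term loses `y`, the minus term keeps `d`
(display (B), C40L42–L46).
[cite: Hu2025, Def. 5.4 / Def. 5.13 / Prop. 5.16, pp. 80, 88–92 (unrefereed preprint arXiv:2507.21400v1 under adjudication, D-0012/D-0089 — kernel support on OUR typed carrier of row 106; nothing of the source asserted)] -/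
theorem properTransform_own_block_pi {y d : V} (hyd : y ≠ d) (hc : s.centre = {y, d}) (he : s.exc = y)
    (A M : V →₀ ℕ) (hAy : A y = 0) (hAd : A d = 0) (hMd : M d = 0) :
    s.properTransform ⟨A + Finsupp.single y 1, Finsupp.single d 1 + M⟩ =
      ⟨A, Finsupp.single d 1 + s.pullbackExp M⟩ := by
  have hdy : d ≠ y := fun h => hyd h.symm
  have herase : s.centre.erase y = {d} := by
    rw [hc, Finset.erase_insert (by simp [hyd])]
  have hl : lPhi s.centre (A + Finsupp.single y 1) (Finsupp.single d 1 + M) = 1 := by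
    simp only [lPhi, phiDeg, hc, Finset.sum_pair hyd, Finsupp.coe_add, Pi.add_apply, hAy, hAd, hMd,
      Finsupp.single_apply, hyd, hdy, if_true, if_false]
    omega
  simp only [ChartStep.properTransform, hl, Binomial.mk.injEq]
  constructor
  · ext v
    simp only [pullbackExp, he, herase, Finset.sum_singleton, Finsupp.coe_add, Finsupp.coe_tsub, Pi.add_apply,
      Pi.sub_apply, Finsupp.single_apply, hAd, hyd, if_false]
    split_ifs <;> omega
  · ext v
    simp only [pullbackExp, he, herase, Finset.sum_singleton, Finsupp.coe_add, Finsupp.coe_tsub, Pi.add_apply,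
      Pi.sub_apply, Finsupp.single_apply, hMd, if_true]
    split_ifs <;> omega

end ChartStep

/-! ## List surgery: the word at level `j+1` is the word at level `j` followed by the step of block `j` -/

omit [DecidableEq V] in
/-- `[0,…,N−1]` filtered by `< m` is `[0,…,m−1]` (list bookkeeping for the words of the charts). [cite: Hu2025, Def. 5.4 / Def. 5.13 / Prop. 5.16, pp. 80, 88–92 (unrefereed preprint arXiv:2507.21400v1 under adjudication, D-0012/D-0089 — kernel support on OUR typed carrier of row 106; nothing of the source asserted)] -/
theorem range_filter_lt (N m : ℕ) (h : m ≤ N) :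
    (List.range N).filter (fun i => decide (i < m)) = List.range m := by
  induction N with
  | zero =>
    obtain rfl : m = 0 := Nat.le_zero.mp h
    rfl
  | succ N ih =>
    rcases Nat.lt_or_ge N m with hlt | hge
    · have hm : m = N + 1 := le_antisymm h hlt
      subst hm
      rw [List.range_succ, List.filter_append,
        List.filter_eq_self.mpr (fun i hi => by simpa using Nat.lt_succ_of_lt (List.mem_range.mp hi))]
      simp
    · rw [List.range_succ, List.filter_append, ih hge]
      simp [Nat.not_lt.mpr hge]

end Literature.AlgebraicGeometry.Hu2025.Statements.S05ThetaBlowups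

end
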